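import Literature.NumberTheory.Sieve.SmoothZetaDecayTotal
import Literature.NumberTheory.Sieve.SmoothZetaDecayPNT
import Literature.NumberTheory.Sieve.SmoothZetaDecayNearAxisSaddle
import HarnessLib

/-!
# Decay of `ζ(α + it, y)/ζ(α, y)` off the real axis at the saddle point, range `(log x)³ ≤ y ≤ x^{1/(log log y)³}`

Topic `Literature/NumberTheory/Sieve`; a PROVED tool file toward Hildebrand–Tenenbaum's Theorem 1 WITHOUT their
Lemma 6 (no zero-free region). With `α = α(x, y)` the saddle point, `u = log x/log y`, Hildebrand–Tenenbaum's Lemma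
8 (ii) gives `|ζ(α + it, y)/ζ(α, y)| ≤ exp(-c ū t²/((1-α)² + t²))` for `1/log y ≤ |t| ≤ Y(ε)`. Here, from the
elementary decay sums of the tree (classical prime number theorem `SmoothZetaDecayPNT`, Chebyshev ranges and
Brun–Titchmarsh blocks `SmoothZetaDecayTotal`), we prove the much weaker but VK-free

* `exists_norm_smoothZetaC_saddlePoint_le_div_log_cube` — there are `y₀`, `u₀` and `κ > 0` such that for all
  `x ≥ y ≥ y₀` with `(log x)³ ≤ y`, `u ≥ u₀` and `u ≥ (log log y)³`:
  `|ζ(α + it, y)| ≤ ζ(α, y)/(log x)³` for all `π/log y ≤ |t| ≤ κ y^{9/20}`,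

which is what the Gaussian-smoothed saddle-point argument needs off the window. The three zones: `|t| ≤ 3` and
`u ≤ (log y)^{19/10}` (prime number theorem: `W ≫ u/log³u`), `|t| ≤ 3` and `u > (log y)^{19/10}` (top Chebyshev
range: `W ≫ u^{14/15}/log y ≫ u^{2/5}`), `3 ≤ |t| ≤ κ y^{9/20}` (Brun–Titchmarsh blocks above `√y`: `W ≫ u/log u`);
the sizes `y^{1-α} ≍ u log(u+1)` are the tree's `rpow_one_sub_saddlePoint_le` / `le_rpow_one_sub_saddlePoint`.
[cite: HildebrandTenenbaum1986, Lemma 8 (ii) (3.16) and §4, p. 279]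

## References

* [HildebrandTenenbaum1986] A. Hildebrand, G. Tenenbaum, Trans. AMS 296 (1986) 265–290, Lemma 8 and §4
  (held: `paper:doi-10-1090-s0002-9947-1986-0837811-1`, pp. 275–279).
-/

noncomputable section

open Real Finset Filter Asymptotics Complex

namespace Literature.NumberTheory.Sieve

namespace RegimeA

/-! ### Eventual inequalities in `u` -/

/-- `log^k u ≤ c u^s` eventually (`s, c > 0`). [folklore] -/
theorem eventually_log_rpow_le (k : ℝ) {s c : ℝ} (hs : 0 < s) (hc : 0 < c) :
    ∀ᶠ u : ℝ in atTop, Real.log u ^ k ≤ c * u ^ s := by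
  have h := (isLittleO_log_rpow_rpow_atTop k hs).def hc
  filter_upwards [h, eventually_ge_atTop (1 : ℝ)] with u hu hu1
  have h1 : 0 ≤ Real.log u := Real.log_nonneg hu1
  rw [Real.norm_of_nonneg (Real.rpow_nonneg h1 k), Real.norm_of_nonneg (Real.rpow_nonneg (by linarith) s)] at hu
  exact hu

/-- Zone `|t| ≤ 3`, `u ≤ (log y)^{19/10}`: eventually
`B u^{9/19} ℓ + 3ℓ + 3u^{1/3} + 4 ≤ A u/ℓ³` (`ℓ = log u`). [folklore] -/
theorem eventually_zone1_small {A B : ℝ} (hA : 0 < A) (hB : 0 < B) :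
    ∀ᶠ u : ℝ in atTop, B * u ^ (9 / 19 : ℝ) * Real.log u + 3 * Real.log u + 3 * u ^ (1 / 3 : ℝ) + 4 ≤
      A * u / Real.log u ^ 3 := by
  have h1 := eventually_log_rpow_le 4 (s := 10 / 19) (c := A / (4 * B)) (by norm_num) (by positivity)
  have h2 := eventually_log_rpow_le 4 (s := 1) (c := A / 12) (by norm_num) (by positivity)
  have h3 := eventually_log_rpow_le 3 (s := 2 / 3) (c := A / 12) (by norm_num) (by positivity)
  have h4 := eventually_log_rpow_le 3 (s := 1) (c := A / 16) (by norm_num) (by positivity)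
  filter_upwards [h1, h2, h3, h4, eventually_ge_atTop (Real.exp 1)] with u hu1 hu2 hu3 hu4 hue
  have hu0 : 0 < u := lt_of_lt_of_le (Real.exp_pos 1) hue
  have hℓ1 : 1 ≤ Real.log u := by rw [Real.le_log_iff_exp_le hu0]; exact hue
  have hℓ0 : 0 < Real.log u := by linarith
  set ℓ : ℝ := Real.log u with hℓ
  have hℓ3 : 0 < ℓ ^ 3 := by positivity
  rw [le_div_iff₀ hℓ3]
  -- convert the real powers of `ℓ`
  have e4 : ℓ ^ (4 : ℝ) = ℓ ^ 4 := by rw [show (4 : ℝ) = (4 : ℕ) by norm_num, Real.rpow_natCast]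
  have e3 : ℓ ^ (3 : ℝ) = ℓ ^ 3 := by rw [show (3 : ℝ) = (3 : ℕ) by norm_num, Real.rpow_natCast]
  rw [e4] at hu1 hu2
  rw [e3] at hu3 hu4
  rw [Real.rpow_one] at hu2 hu4
  -- `u^{9/19} u^{10/19} = u`, `u^{1/3} u^{2/3} = u`
  have hsplit1 : u ^ (9 / 19 : ℝ) * u ^ (10 / 19 : ℝ) = u := by
    rw [← Real.rpow_add hu0]; norm_num
  have hsplit2 : u ^ (1 / 3 : ℝ) * u ^ (2 / 3 : ℝ) = u := by
    rw [← Real.rpow_add hu0]; norm_num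
  have hp1 : 0 ≤ u ^ (9 / 19 : ℝ) := Real.rpow_nonneg hu0.le _
  have hp2 : 0 ≤ u ^ (1 / 3 : ℝ) := Real.rpow_nonneg hu0.le _
  -- the four pieces
  have k1 : B * u ^ (9 / 19 : ℝ) * ℓ * ℓ ^ 3 ≤ A / 4 * u := by
    have : B * u ^ (9 / 19 : ℝ) * (ℓ ^ 4) ≤ B * u ^ (9 / 19 : ℝ) * (A / (4 * B) * u ^ (10 / 19 : ℝ)) :=
      mul_le_mul_of_nonneg_left hu1 (by positivity)
    have heq : B * u ^ (9 / 19 : ℝ) * (A / (4 * B) * u ^ (10 / 19 : ℝ)) = A / 4 * u := by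
      have : B * u ^ (9 / 19 : ℝ) * (A / (4 * B) * u ^ (10 / 19 : ℝ)) =
          A / 4 * (u ^ (9 / 19 : ℝ) * u ^ (10 / 19 : ℝ)) := by
        field_simp
      rw [this, hsplit1]
    nlinarith
  have k2 : 3 * ℓ * ℓ ^ 3 ≤ A / 4 * u := by nlinarith
  have k3 : 3 * u ^ (1 / 3 : ℝ) * ℓ ^ 3 ≤ A / 4 * u := by
    have : 3 * u ^ (1 / 3 : ℝ) * ℓ ^ 3 ≤ 3 * u ^ (1 / 3 : ℝ) * (A / 12 * u ^ (2 / 3 : ℝ)) :=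
      mul_le_mul_of_nonneg_left hu3 (by positivity)
    have heq : 3 * u ^ (1 / 3 : ℝ) * (A / 12 * u ^ (2 / 3 : ℝ)) = A / 4 * u := by
      have : 3 * u ^ (1 / 3 : ℝ) * (A / 12 * u ^ (2 / 3 : ℝ)) = A / 4 * (u ^ (1 / 3 : ℝ) * u ^ (2 / 3 : ℝ)) := by
        ring
      rw [this, hsplit2]
    linarith
  have k4 : 4 * ℓ ^ 3 ≤ A / 4 * u := by nlinarith
  nlinarith

/-- Zone `|t| ≤ 3`, `u > (log y)^{19/10}`: eventually `6ℓ ≤ A u^{116/285}`. [folklore] -/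
theorem eventually_zone1_large {A : ℝ} (hA : 0 < A) :
    ∀ᶠ u : ℝ in atTop, 6 * Real.log u ≤ A * u ^ (116 / 285 : ℝ) := by
  have h := eventually_log_rpow_le 1 (s := 116 / 285) (c := A / 6) (by norm_num) (by positivity)
  filter_upwards [h] with u hu
  rw [Real.rpow_one] at hu
  linarith

/-- Zone `3 ≤ |t|`: eventually `3ℓ + 3u^{1/3} ≤ A u/ℓ`. [folklore] -/
theorem eventually_zone2 {A : ℝ} (hA : 0 < A) :
    ∀ᶠ u : ℝ in atTop, 3 * Real.log u + 3 * u ^ (1 / 3 : ℝ) ≤ A * u / Real.log u := by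
  have h1 := eventually_log_rpow_le 2 (s := 1) (c := A / 6) (by norm_num) (by positivity)
  have h2 := eventually_log_rpow_le 1 (s := 2 / 3) (c := A / 6) (by norm_num) (by positivity)
  filter_upwards [h1, h2, eventually_ge_atTop (Real.exp 1)] with u hu1 hu2 hue
  have hu0 : 0 < u := lt_of_lt_of_le (Real.exp_pos 1) hue
  have hℓ1 : 1 ≤ Real.log u := by rw [Real.le_log_iff_exp_le hu0]; exact hue
  have hℓ0 : 0 < Real.log u := by linarith
  rw [le_div_iff₀ hℓ0]
  have e2 : Real.log u ^ (2 : ℝ) = Real.log u ^ 2 := by rw [show (2 : ℝ) = (2 : ℕ) by norm_num, Real.rpow_natCast]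
  rw [e2, Real.rpow_one] at hu1
  rw [Real.rpow_one] at hu2
  have hsplit : u ^ (1 / 3 : ℝ) * u ^ (2 / 3 : ℝ) = u := by rw [← Real.rpow_add hu0]; norm_num
  have k2 : 3 * u ^ (1 / 3 : ℝ) * Real.log u ≤ A / 2 * u := by
    have : 3 * u ^ (1 / 3 : ℝ) * Real.log u ≤ 3 * u ^ (1 / 3 : ℝ) * (A / 6 * u ^ (2 / 3 : ℝ)) :=
      mul_le_mul_of_nonneg_left hu2 (by positivity)
    have heq : 3 * u ^ (1 / 3 : ℝ) * (A / 6 * u ^ (2 / 3 : ℝ)) = A / 2 * u := by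
      have : 3 * u ^ (1 / 3 : ℝ) * (A / 6 * u ^ (2 / 3 : ℝ)) = A / 2 * (u ^ (1 / 3 : ℝ) * u ^ (2 / 3 : ℝ)) := by
        ring
      rw [this, hsplit]
    linarith
  nlinarith

/-- `2 C ℓ ≤ u²` eventually. [folklore] -/
theorem eventually_mul_log_le_sq {C : ℝ} (hC : 0 < C) : ∀ᶠ u : ℝ in atTop, 2 * C * Real.log u ≤ u ^ 2 := by
  have h := eventually_log_rpow_le 1 (s := 2) (c := 1 / (2 * C)) (by norm_num) (by positivity)
  filter_upwards [h] with u hu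
  rw [Real.rpow_one, show (2 : ℝ) = ((2 : ℕ) : ℝ) by norm_num, Real.rpow_natCast] at hu
  have := mul_le_mul_of_nonneg_left hu (show 0 ≤ 2 * C by positivity)
  have heq : 2 * C * (1 / (2 * C) * u ^ 2) = u ^ 2 := by field_simp
  linarith

end RegimeA

open RegimeA in
set_option maxHeartbeats 1600000 in
/-- **Off-axis decay at the saddle point, range `(log x)³ ≤ y`, `u ≥ (log log y)³` — without zero-free regions.**
There are `y₀`, `u₀` and `κ > 0` such that for all real `x` and natural `y` with `y ≥ y₀`, `(log x)³ ≤ y ≤ x`,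
`u = log x/log y ≥ u₀` and `u ≥ (log log y)³`, and all real `t` with `π/log y ≤ |t| ≤ κ y^{9/20}`:
`|ζ(α + it, y)| ≤ ζ(α, y)/(log x)³`, `α = α(x, y)`.
(`W(t) ≥ 3 log log x` in each of the three zones of the module docstring, then
`|ζ(α+it, y)| ≤ ζ(α, y) e^{-W}`; any fixed power of `log x` could be had the same way.)
[cite: HildebrandTenenbaum1986, Lemma 8 (ii) (3.16); §4 p. 279] -/
theorem exists_norm_smoothZetaC_saddlePoint_le_div_log_cube :
    ∃ y₀ : ℕ, ∃ u₀ κ : ℝ, 0 < κ ∧ ∀ (x : ℝ) (y : ℕ), y₀ ≤ y → Real.log x ^ 3 ≤ y → (y : ℝ) ≤ x →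
      u₀ ≤ Real.log x / Real.log y → Real.log (Real.log y) ^ 3 ≤ Real.log x / Real.log y →
      ∀ t : ℝ, Real.pi / Real.log y ≤ |t| → |t| ≤ κ * (y : ℝ) ^ (9 / 20 : ℝ) →
        ‖smoothZetaC ((saddlePoint x y : ℂ) + t * I) y‖ ≤ smoothZeta (saddlePoint x y) y / Real.log x ^ 3 := by
  obtain ⟨Cup, x₁, hCup, hup⟩ := rpow_one_sub_saddlePoint_le
  obtain ⟨clo, x₂, hclo, hlo⟩ := le_rpow_one_sub_saddlePoint
  obtain ⟨C₆, hC₆0, hD6⟩ := DecayPNT.exists_decaySum_ge_pnt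
  obtain ⟨c₃, hc₃, κ, hκ, y₃, hZ2⟩ := exists_decaySum_ge_of_three_le
  obtain ⟨c₄, hc₄, y₄, hZ1L⟩ := exists_decaySum_ge_of_le_three
  -- the eventual inequalities in `u`
  set A₁ : ℝ := clo / 7 with hA₁
  set B₁ : ℝ := 8 * (C₆ + 1) * Cup with hB₁
  set A₂ : ℝ := c₄ * Real.exp (-4) * clo ^ (14 / 15 : ℝ) with hA₂
  set A₃ : ℝ := c₃ * Real.exp (-3) * clo / 18 with hA₃
  have hA₁0 : 0 < A₁ := by positivity
  have hB₁0 : 0 < B₁ := by positivity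
  have hA₂0 : 0 < A₂ := by positivity
  have hA₃0 : 0 < A₃ := by positivity
  have hev := (eventually_zone1_small hA₁0 hB₁0).and ((eventually_zone1_large hA₂0).and
    ((eventually_zone2 hA₃0).and ((eventually_mul_log_le_sq hCup).and
      (eventually_ge_atTop (max (Real.exp 4) (Real.exp 2 / clo + 2))))))
  obtain ⟨U, hU⟩ := Filter.eventually_atTop.1 hev
  refine ⟨max (max ⌈x₁⌉₊ ⌈x₂⌉₊) (max (max y₃ y₄) ⌈Real.exp 3⌉₊), U, κ, hκ,
    fun x y hy hxy3 hyx hu hLL t htπ htκ => ?_⟩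
  -- ### unpack the thresholds
  have hyx₁ : x₁ ≤ y := le_trans (Nat.le_ceil _)
    (by exact_mod_cast le_trans (le_max_left _ _) (le_trans (le_max_left _ _) hy))
  have hyx₂ : x₂ ≤ y := le_trans (Nat.le_ceil _)
    (by exact_mod_cast le_trans (le_max_right _ _) (le_trans (le_max_left _ _) hy))
  have hyy₃ : y₃ ≤ y := le_trans (le_max_left _ _) (le_trans (le_max_left _ _) (le_trans (le_max_right _ _) hy))
  have hyy₄ : y₄ ≤ y := le_trans (le_max_right _ _) (le_trans (le_max_left _ _) (le_trans (le_max_right _ _) hy))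
  have hye3 : Real.exp 3 ≤ y := le_trans (Nat.le_ceil _)
    (by exact_mod_cast le_trans (le_max_right _ _) (le_trans (le_max_right _ _) hy))
  have hy0 : (0 : ℝ) < y := lt_of_lt_of_le (Real.exp_pos 3) hye3
  have he3 : (4 : ℝ) ≤ Real.exp 3 := by have := Real.add_one_le_exp (3 : ℝ); linarith
  have hy1 : (1 : ℝ) < y := by linarith
  have hy2 : 2 ≤ y := by
    have : (2 : ℝ) ≤ y := by linarith
    exact_mod_cast this
  set L : ℝ := Real.log y with hL
  have hL3 : 3 ≤ L := by have := Real.log_le_log (Real.exp_pos 3) hye3; rwa [Real.log_exp] at this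
  have hL0 : 0 < L := by linarith
  have hx1 : 1 < x := lt_of_lt_of_le hy1 hyx
  have hxx₁ : x₁ ≤ x := hyx₁.trans hyx
  have hxx₂ : x₂ ≤ x := hyx₂.trans hyx
  set u : ℝ := Real.log x / L with hudef
  obtain ⟨hE1, hE2, hE3, hE4, hU0⟩ := hU u hu
  have hue4 : Real.exp 4 ≤ u := le_trans (le_max_left _ _) hU0
  have hu_clo : Real.exp 2 / clo + 2 ≤ u := le_trans (le_max_right _ _) hU0
  have he4 : (5 : ℝ) ≤ Real.exp 4 := by have := Real.add_one_le_exp (4 : ℝ); linarith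
  have hu2 : 2 ≤ u := by linarith
  have hu0 : 0 < u := by linarith
  have hu1 : 1 ≤ u := by linarith
  have huL : u * L = Real.log x := by rw [hudef]; field_simp
  set ℓ : ℝ := Real.log u with hℓ
  have hℓ4 : 4 ≤ ℓ := by rw [hℓ, Real.le_log_iff_exp_le hu0]; exact hue4
  have hℓ0 : 0 < ℓ := by linarith
  have hπ3 := Real.pi_gt_three
  have hπ4 := Real.pi_le_four
  -- `log L ≤ u^{1/3}`
  have hlogL : Real.log L ≤ u ^ (1 / 3 : ℝ) := by
    rcases le_or_gt (Real.log L) 0 with h | h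
    · exact h.trans (Real.rpow_nonneg hu0.le _)
    · have h1 := Real.rpow_le_rpow (by positivity : 0 ≤ Real.log L ^ 3) hLL (by norm_num : (0 : ℝ) ≤ 1 / 3)
      rw [← Real.rpow_natCast, ← Real.rpow_mul h.le] at h1
      norm_num at h1
      exact h1
  -- ### the saddle point and `E = y^{1-α} = e^{ξ̃}`
  set α : ℝ := saddlePoint x y with hαdef
  have hα0 : 0 < α := saddlePoint_pos hx1 hy2
  set b : ℝ := 1 - α with hb
  set E : ℝ := (y : ℝ) ^ b with hEdef
  have hE0 : 0 < E := Real.rpow_pos_of_pos hy0 _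
  have hlog1 : 1 ≤ Real.log (u + 1) := by
    rw [Real.le_log_iff_exp_le (by linarith)]
    have := Real.exp_one_lt_d9; linarith
  have hlog2 : Real.log (u + 1) ≤ 2 * ℓ := by
    rw [hℓ, ← Real.log_rpow hu0, show ((2 : ℝ)) = ((2 : ℕ) : ℝ) by norm_num, Real.rpow_natCast]
    exact Real.log_le_log (by linarith) (by nlinarith only [hu2])
  have hElo : clo * (u * Real.log (u + 1)) ≤ E := hlo x y hxx₂ hxy3 hyx
  have hEup : E ≤ Cup * (u * Real.log (u + 1)) := hup x y hxx₁ hxy3 hyx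
  have hEclo : clo * u ≤ E := by
    have : clo * u * 1 ≤ clo * u * Real.log (u + 1) := mul_le_mul_of_nonneg_left hlog1 (by positivity)
    linarith
  have hECup : E ≤ 2 * Cup * u * ℓ := by
    have : Cup * (u * Real.log (u + 1)) ≤ Cup * (u * (2 * ℓ)) :=
      mul_le_mul_of_nonneg_left (mul_le_mul_of_nonneg_left hlog2 hu0.le) hCup.le
    linarith
  set ξt : ℝ := L * b with hξt
  have hEexp : E = Real.exp ξt := by rw [hEdef, Real.rpow_def_of_pos hy0, ← hL]
  -- `ξ̃ ≥ 2`
  have hE2e : Real.exp 2 ≤ E := by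
    have h1 : clo * (Real.exp 2 / clo + 2) ≤ clo * u := mul_le_mul_of_nonneg_left hu_clo hclo.le
    have h2 : clo * (Real.exp 2 / clo + 2) = Real.exp 2 + 2 * clo := by field_simp
    linarith
  have hξ2 : 2 ≤ ξt := by rw [hEexp] at hE2e; exact Real.exp_le_exp.1 hE2e
  have hb0 : 0 < b := by
    by_contra h
    push Not at h
    have : ξt ≤ 0 := by rw [hξt]; exact mul_nonpos_of_nonneg_of_nonpos hL0.le h
    linarith
  have hα1 : α < 1 := by rw [hb] at hb0; linarith
  have hb1 : b ≤ 1 := by rw [hb]; linarith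
  -- `ξ̃ ≤ 3ℓ` (from `E ≤ 2 Cup u ℓ ≤ u³`)
  have hξ3 : ξt ≤ 3 * ℓ := by
    have h1 : E ≤ u ^ 2 * u := by
      calc E ≤ 2 * Cup * u * ℓ := hECup
        _ = (2 * Cup * ℓ) * u := by ring
        _ ≤ u ^ 2 * u := mul_le_mul_of_nonneg_right hE4 hu0.le
    have h2 : u ^ 2 * u = Real.exp (3 * ℓ) := by
      rw [hℓ, show (3 : ℝ) * Real.log u = Real.log u + Real.log u + Real.log u by ring, Real.exp_add,
        Real.exp_add, Real.exp_log hu0]; ring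
    rw [hEexp, h2] at h1
    exact Real.exp_le_exp.1 h1
  -- ### the decay sum `W` is `≥ 2ℓ + 2 log L` in each zone
  set W : ℝ := ∑ p ∈ Nat.primesLE y, (p : ℝ) ^ (-α) * (1 - Real.cos (t * Real.log p)) with hW
  have htpos : 0 < |t| := lt_of_lt_of_le (by positivity) htπ
  have ht0 : t ≠ 0 := abs_pos.1 htpos
  have hWge : 3 * ℓ + 3 * Real.log L ≤ W := by
    rcases le_or_gt |t| 3 with ht3 | ht3
    · by_cases hsmall : u ≤ L ^ (19 / 10 : ℝ)
      · -- zone 1, `u ≤ L^{19/10}`: the prime number theorem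
        have hW6 := hD6 y hy2 α t hα0.le hα1
        rw [← hb, ← hL, ← hEdef] at hW6
        -- (i) the main term
        have hπtL : Real.pi ≤ |t| * L := by rwa [div_le_iff₀ hL0] at htπ
        have hsq : Real.pi ^ 2 ≤ t ^ 2 * L ^ 2 := by
          have h1 := mul_self_le_mul_self (by positivity) hπtL
          have h2 : |t| * L * (|t| * L) = t ^ 2 * L ^ 2 := by rw [← sq_abs t]; ring
          rw [h2, ← sq] at h1
          exact h1
        have hden1 : 0 < 2 * b * (b ^ 2 + t ^ 2) := by positivity
        have hden2 : 0 < 2 * ξt * (ξt ^ 2 + Real.pi ^ 2) := by positivity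
        have hi : E * L * Real.pi ^ 2 / (2 * ξt * (ξt ^ 2 + Real.pi ^ 2)) ≤ E * t ^ 2 / (2 * b * (b ^ 2 + t ^ 2)) := by
          rw [div_le_div_iff₀ hden2 hden1]
          have key : E * t ^ 2 * (2 * ξt * (ξt ^ 2 + Real.pi ^ 2)) - E * L * Real.pi ^ 2 * (2 * b * (b ^ 2 + t ^ 2)) =
              2 * (E * L * b) * (b ^ 2 * (t ^ 2 * L ^ 2 - Real.pi ^ 2)) := by rw [hξt]; ring
          have hnn : 0 ≤ 2 * (E * L * b) * (b ^ 2 * (t ^ 2 * L ^ 2 - Real.pi ^ 2)) := by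
            have : 0 ≤ t ^ 2 * L ^ 2 - Real.pi ^ 2 := by linarith
            positivity
          linarith
        -- (ii), (iii) the error terms
        have hii : C₆ * (1 + |t|) * E ≤ B₁ * u * ℓ := by
          have h1 : C₆ * (1 + |t|) * E ≤ C₆ * 4 * E := by
            have := mul_le_mul_of_nonneg_left (show 1 + |t| ≤ 4 by linarith) hC₆0
            exact mul_le_mul_of_nonneg_right this hE0.le
          have h2 : C₆ * 4 * E ≤ C₆ * 4 * (2 * Cup * u * ℓ) := mul_le_mul_of_nonneg_left hECup (by positivity)
          have h3 : C₆ * 4 * (2 * Cup * u * ℓ) ≤ B₁ * u * ℓ := by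
            have h0 : 0 ≤ Cup * u * ℓ := by positivity
            rw [hB₁]; nlinarith only [h0]
          linarith
        have hiii : 4 / b ≤ 2 * L := by
          rw [div_le_iff₀ hb0]; rw [hξt] at hξ2; linarith
        -- so `W ≥ E π²/(2ξ̃(ξ̃²+π²)) - B₁ u ℓ/L - 2`
        have hWlow : E * Real.pi ^ 2 / (2 * ξt * (ξt ^ 2 + Real.pi ^ 2)) - B₁ * u * ℓ / L - 2 ≤ W := by
          refine le_trans ?_ hW6
          rw [le_div_iff₀ hL0]
          have h1 : (E * Real.pi ^ 2 / (2 * ξt * (ξt ^ 2 + Real.pi ^ 2)) - B₁ * u * ℓ / L - 2) * L =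
              E * L * Real.pi ^ 2 / (2 * ξt * (ξt ^ 2 + Real.pi ^ 2)) - B₁ * u * ℓ - 2 * L := by
            field_simp
          rw [h1]
          linarith
        -- (iv) `E π²/(2ξ̃(ξ̃²+π²)) ≥ A₁ u/ℓ³`
        have hiv : A₁ * u / ℓ ^ 3 ≤ E * Real.pi ^ 2 / (2 * ξt * (ξt ^ 2 + Real.pi ^ 2)) := by
          have hℓ3 : 0 < ℓ ^ 3 := by positivity
          rw [div_le_div_iff₀ hℓ3 hden2]
          have h1 : 2 * ξt * (ξt ^ 2 + Real.pi ^ 2) ≤ 60 * ℓ ^ 3 := by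
            have hπℓ : Real.pi ^ 2 ≤ ℓ ^ 2 := pow_le_pow_left₀ (by positivity) (hπ4.trans hℓ4) 2
            have hξ0 : 0 ≤ ξt := by linarith only [hξ2]
            have hξsq : ξt ^ 2 ≤ (3 * ℓ) ^ 2 := pow_le_pow_left₀ hξ0 hξ3 2
            calc 2 * ξt * (ξt ^ 2 + Real.pi ^ 2) ≤ 2 * (3 * ℓ) * ((3 * ℓ) ^ 2 + ℓ ^ 2) := by
                  apply mul_le_mul (by linarith only [hξ3]) (add_le_add hξsq hπℓ) (by positivity)
                    (by positivity)
              _ = 60 * ℓ ^ 3 := by ring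
          have h2 : A₁ * u * (2 * ξt * (ξt ^ 2 + Real.pi ^ 2)) ≤ A₁ * u * (60 * ℓ ^ 3) :=
            mul_le_mul_of_nonneg_left h1 (by positivity)
          have h3 : A₁ * u * (60 * ℓ ^ 3) ≤ E * Real.pi ^ 2 * ℓ ^ 3 := by
            rw [hA₁]
            have h4 : (60 : ℝ) / 7 ≤ Real.pi ^ 2 := by nlinarith only [hπ3]
            have h5 : clo / 7 * u * (60 * ℓ ^ 3) = (60 / 7) * (clo * u) * ℓ ^ 3 := by ring
            rw [h5]
            have h6 := mul_le_mul h4 hEclo (by positivity) (by positivity)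
            have h7 := mul_le_mul_of_nonneg_right h6 hℓ3.le
            calc 60 / 7 * (clo * u) * ℓ ^ 3 ≤ Real.pi ^ 2 * E * ℓ ^ 3 := h7
              _ = E * Real.pi ^ 2 * ℓ ^ 3 := by ring
          linarith only [h2, h3]
        -- (v) `u ℓ/L ≤ u^{9/19} ℓ`
        have hv : B₁ * u * ℓ / L ≤ B₁ * u ^ (9 / 19 : ℝ) * ℓ := by
          have hLu : u ^ (10 / 19 : ℝ) ≤ L := by
            have h1 := Real.rpow_le_rpow hu0.le hsmall (by norm_num : (0 : ℝ) ≤ 10 / 19)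
            rw [← Real.rpow_mul hL0.le] at h1
            norm_num at h1
            exact h1
          have hup : 0 < u ^ (10 / 19 : ℝ) := Real.rpow_pos_of_pos hu0 _
          have h2 : u / L ≤ u ^ (9 / 19 : ℝ) := by
            calc u / L ≤ u / u ^ (10 / 19 : ℝ) := div_le_div_of_nonneg_left hu0.le hup hLu
              _ = u ^ (9 / 19 : ℝ) := by
                  rw [show (9 / 19 : ℝ) = 1 - 10 / 19 by norm_num, Real.rpow_sub hu0, Real.rpow_one]
          have : B₁ * u * ℓ / L = B₁ * ℓ * (u / L) := by field_simp
          rw [this]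
          calc B₁ * ℓ * (u / L) ≤ B₁ * ℓ * u ^ (9 / 19 : ℝ) := mul_le_mul_of_nonneg_left h2 (by positivity)
            _ = B₁ * u ^ (9 / 19 : ℝ) * ℓ := by ring
        have hlogL' : 3 * Real.log L ≤ 3 * u ^ (1 / 3 : ℝ) := by linarith only [hlogL]
        linarith only [hE1, hlogL', hWlow, hiv, hv]
      · -- zone 1, `u > L^{19/10}`: the top Chebyshev range
        push Not at hsmall
        have hW4 := hZ1L y hyy₄ α hα0.le hα1.le t ht0 ht3 htπ
        rw [← hb, ← hL] at hW4
        set Λ : ℝ := 4 + 1 / (5 * |t|) with hΛ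
        have hΛ0 : 0 < Λ := by positivity
        -- `(y e^{-Λ})^b = E e^{-Λ b} ≥ e^{-4} E^{14/15}`
        have hsplit : ((y : ℝ) * Real.exp (-Λ)) ^ b = E * Real.exp (-Λ * b) := by
          rw [Real.mul_rpow hy0.le (Real.exp_pos _).le, ← hEdef, Real.exp_mul]
        have hΛb : Λ * b ≤ 4 + ξt / 15 := by
          have h1 : 1 / (5 * |t|) ≤ L / (5 * Real.pi) := by
            rw [div_le_div_iff₀ (by positivity) (by positivity)]
            have := (div_le_iff₀ hL0).1 htπ
            linarith only [this]
          have h2 : Λ * b = 4 * b + b * (1 / (5 * |t|)) := by rw [hΛ]; ring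
          have h3 : b * (1 / (5 * |t|)) ≤ b * (L / (5 * Real.pi)) := mul_le_mul_of_nonneg_left h1 hb0.le
          have h4 : b * (L / (5 * Real.pi)) ≤ ξt / 15 := by
            calc b * (L / (5 * Real.pi)) = (L * b) / (5 * Real.pi) := by ring
              _ ≤ (L * b) / 15 := div_le_div_of_nonneg_left (by positivity) (by norm_num) (by linarith only [hπ3])
              _ = ξt / 15 := by rw [hξt]
          have h5 : 4 * b ≤ 4 := by linarith only [hb1]
          linarith only [h2, h3, h4, h5]
        have hpow : Real.exp (-4) * E ^ (14 / 15 : ℝ) ≤ ((y : ℝ) * Real.exp (-Λ)) ^ b := by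
          rw [hsplit]
          have h1 : Real.exp (-(4 + ξt / 15)) ≤ Real.exp (-Λ * b) := Real.exp_le_exp.2 (by linarith only [hΛb])
          have h2 : E ^ (14 / 15 : ℝ) = E * Real.exp (-(ξt / 15)) := by
            rw [hEexp, ← Real.exp_mul, ← Real.exp_add]; congr 1; ring
          calc Real.exp (-4) * E ^ (14 / 15 : ℝ) = E * Real.exp (-(4 + ξt / 15)) := by
                rw [h2, show -(4 + ξt / 15) = -4 + -(ξt / 15) by ring, Real.exp_add]; ring
            _ ≤ E * Real.exp (-Λ * b) := mul_le_mul_of_nonneg_left h1 hE0.le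
        have hE1415 : (clo * u) ^ (14 / 15 : ℝ) ≤ E ^ (14 / 15 : ℝ) :=
          Real.rpow_le_rpow (by positivity) hEclo (by norm_num)
        have hcu : (clo * u) ^ (14 / 15 : ℝ) = clo ^ (14 / 15 : ℝ) * u ^ (14 / 15 : ℝ) :=
          Real.mul_rpow hclo.le hu0.le
        -- `L ≤ u^{10/19}` and `u^{14/15}/u^{10/19} = u^{116/285}`
        have hLu : L ≤ u ^ (10 / 19 : ℝ) := by
          have h1 := Real.rpow_le_rpow (by positivity) hsmall.le (by norm_num : (0 : ℝ) ≤ 10 / 19)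
          rw [← Real.rpow_mul hL0.le] at h1
          norm_num at h1
          exact h1
        have hup : 0 < u ^ (10 / 19 : ℝ) := Real.rpow_pos_of_pos hu0 _
        have hquot : u ^ (14 / 15 : ℝ) / u ^ (10 / 19 : ℝ) = u ^ (116 / 285 : ℝ) := by
          rw [← Real.rpow_sub hu0]; norm_num
        have hWlow : A₂ * u ^ (116 / 285 : ℝ) ≤ W := by
          refine le_trans ?_ hW4
          have h1 : c₄ * (Real.exp (-4) * (clo ^ (14 / 15 : ℝ) * u ^ (14 / 15 : ℝ)) / L) ≤
              c₄ * (((y : ℝ) * Real.exp (-Λ)) ^ b / L) := by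
            refine mul_le_mul_of_nonneg_left (div_le_div_of_nonneg_right ?_ hL0.le) hc₄.le
            rw [← hcu]
            exact le_trans (mul_le_mul_of_nonneg_left hE1415 (Real.exp_pos _).le) hpow
          refine le_trans ?_ h1
          have h2 : u ^ (14 / 15 : ℝ) / u ^ (10 / 19 : ℝ) ≤ u ^ (14 / 15 : ℝ) / L :=
            div_le_div_of_nonneg_left (Real.rpow_nonneg hu0.le _) hL0 hLu
          rw [hquot] at h2
          have h3 : c₄ * (Real.exp (-4) * (clo ^ (14 / 15 : ℝ) * u ^ (14 / 15 : ℝ)) / L) =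
              A₂ * (u ^ (14 / 15 : ℝ) / L) := by rw [hA₂]; ring
          rw [h3]
          exact mul_le_mul_of_nonneg_left h2 hA₂0.le
        -- `log L ≤ ℓ`
        have hlogL' : Real.log L ≤ ℓ := by
          have hLu' : L ≤ u := hLu.trans (by
            calc u ^ (10 / 19 : ℝ) ≤ u ^ (1 : ℝ) := Real.rpow_le_rpow_of_exponent_le hu1 (by norm_num)
              _ = u := Real.rpow_one u)
          exact Real.log_le_log hL0 hLu'
        linarith only [hE2, hWlow, hlogL']
    · -- zone 2, `3 ≤ |t| ≤ κ y^{9/20}`: Brun–Titchmarsh blocks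
      have hW3 := hZ2 y hyy₃ α hα0.le hα1 t ht3.le htκ
      rw [← hb, ← hL, ← hEdef] at hW3
      have hhalf : (y : ℝ) ^ (b / 2) ≤ E / 2 := by
        have h1 : (y : ℝ) ^ (b / 2) = Real.exp (ξt / 2) := by
          rw [Real.rpow_def_of_pos hy0, hξt, hL]; ring_nf
        have h2 : (2 : ℝ) ≤ Real.exp (ξt / 2) := by
          have := Real.add_one_le_exp (ξt / 2); linarith
        have h3 : E = Real.exp (ξt / 2) * Real.exp (ξt / 2) := by rw [hEexp, ← Real.exp_add]; ring_nf
        rw [h1, h3]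
        nlinarith only [h2, Real.exp_pos (ξt / 2)]
      have hexp3 : Real.exp (-3) ≤ Real.exp (-(3 * b)) := Real.exp_le_exp.2 (by linarith only [hb1])
      have hnum : c₃ * Real.exp (-3) * (E / 2) ≤ c₃ * Real.exp (-(3 * b)) * (E - (y : ℝ) ^ (b / 2)) :=
        mul_le_mul (mul_le_mul_of_nonneg_left hexp3 hc₃.le) (by linarith) (by positivity) (by positivity)
      have hden : 3 * b * L ≤ 9 * ℓ := by
        have : 3 * b * L = 3 * ξt := by rw [hξt]; ring
        rw [this]; linarith only [hξ3]
      have hden0 : 0 < 3 * b * L := by positivity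
      have hWlow : A₃ * u / ℓ ≤ W := by
        refine le_trans ?_ hW3
        calc A₃ * u / ℓ = c₃ * Real.exp (-3) * (clo * u / 2) / (9 * ℓ) := by rw [hA₃]; field_simp; ring
          _ ≤ c₃ * Real.exp (-3) * (E / 2) / (9 * ℓ) := by gcongr
          _ ≤ c₃ * Real.exp (-3) * (E / 2) / (3 * b * L) :=
              div_le_div_of_nonneg_left (by positivity) hden0 hden
          _ ≤ c₃ * Real.exp (-(3 * b)) * (E - (y : ℝ) ^ (b / 2)) / (3 * b * L) :=
              div_le_div_of_nonneg_right hnum hden0.le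
      have hlogL' : 3 * Real.log L ≤ 3 * u ^ (1 / 3 : ℝ) := by linarith only [hlogL]
      linarith only [hE3, hWlow, hlogL']
  -- ### conclusion: `|ζ(α+it)| ≤ ζ(α) e^{-W} ≤ ζ(α)/(log x)²`
  have hdecay := norm_smoothZetaC_le_mul_exp_neg_decaySum hα0 t y
  rw [← hW] at hdecay
  have hζ0 : 0 < smoothZeta α y := smoothZeta_pos hα0
  have hlogx0 : 0 < Real.log x := lt_of_lt_of_le hL0 (Real.log_le_log hy0 hyx)
  have hexpW : Real.exp (-W) ≤ 1 / Real.log x ^ 3 := by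
    have h1 : Real.exp (-W) ≤ Real.exp (-(3 * ℓ + 3 * Real.log L)) := Real.exp_le_exp.2 (by linarith)
    have h2 : Real.exp (-(3 * ℓ + 3 * Real.log L)) = 1 / Real.log x ^ 3 := by
      rw [Real.exp_neg, show 3 * ℓ + 3 * Real.log L = (ℓ + Real.log L) + (ℓ + Real.log L) + (ℓ + Real.log L) by ring,
        Real.exp_add, Real.exp_add, Real.exp_add, hℓ, Real.exp_log hu0, Real.exp_log hL0, huL]
      field_simp
    rw [h2] at h1
    exact h1
  calc ‖smoothZetaC ((α : ℂ) + t * I) y‖ ≤ smoothZeta α y * Real.exp (-W) := hdecay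
    _ ≤ smoothZeta α y * (1 / Real.log x ^ 3) := mul_le_mul_of_nonneg_left hexpW hζ0.le
    _ = smoothZeta α y / Real.log x ^ 3 := by ring


end Literature.NumberTheory.Sieve

end
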